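import Literature.NumberTheory.GaloisRepresentations.CoeffDAction
import Literature.NumberTheory.GaloisRepresentations.PAdicHodgeProofs
import Mathlib.RingTheory.TensorProduct.Free
import Mathlib.LinearAlgebra.InvariantBasisNumber
import HarnessLib

/-!
# The twisted period rings `B ⊗_{F,τ} E` and the rank of the `τ`-components of `D(ρ)`

Let `𝔅` be a period-ring datum for `Γ` over `P` with invariants `F = B^Γ`, `E ⊇ P` a
coefficient field and `τ : F →ₐ[P] E` an embedding.  We introduce

* `TwistCoeff τ` — the field `E` regarded as an `F`-algebra through `τ` (type synonym);
* `TwistRing 𝔅 τ = B ⊗_{F,τ} E` — the "`τ`-twisted period ring", a nonzero commutative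
  `B`-algebra;
* `piTwist 𝔅 n τ : (Fin n → E) ⊗_P B → (TwistRing 𝔅 τ)^n`, `m ⊗ b ↦ (b ⊗ m_i)_i`, compatible
  with the actions of `B` (`piTwist_baseActB`), of `F` (`piTwist_baseAct`) and of `E`
  (`piTwist_smul`), and killing the `τ'`-components `D_{τ'}` for `τ' ≠ τ` (`piTwist_eq_zero_of_mem_labelD`).

and PROVE the **rank lower bound** `le_finrank_labelD`: if `D(ρ) = (M ⊗_P B)^Γ` (for
`M = Eⁿ`) generates `M ⊗_P B` over `B` (hypothesis `hspan`, which holds for `B`-admissible `ρ`,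
`span_D_eq_top`) and `E` splits `F`, then `n ≤ dim_E D_τ(ρ)` for every `τ` — the images of
`D_τ` generate the free rank-`n` module over the nonzero commutative ring `B ⊗_{F,τ} E`, so at
least `n` of them are needed (rank condition).  Together with the dimension count
`dim_E D(ρ) = Σ_τ dim_E D_τ ≤ n [F : P]` this gives `dim_E D_τ = n` (freeness of `D(ρ)` over
`E ⊗_P F`; Fontaine, Patrikis §2.3.1), see `finrank_labelD_eq_of_sum_le`.

No named facts, no `sorry`.

## References

* S. Patrikis, *Variations on a theorem of Tate*, Mem. AMS 258 (2019), §2.3.1. [Patrikis2019]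
* J.-M. Fontaine, Astérisque 223 (1994), Exp. III §1.5. [FontaineAsterisque223III]
-/

noncomputable section

open TensorProduct Module

namespace Literature.NumberTheory.GaloisRepresentations

namespace PeriodRingData

universe u v v' w

/-! ### The twisted coefficient field and the twisted period ring -/

section Twist

variable {P : Type v} {F : Type v'} [Field P] [Field F] [Algebra P F] {E : Type w} [Field E] [Algebra P E]

/-- `E` as an `F`-algebra through the embedding `τ : F → E` (type synonym). [folklore] -/
@[nolint unusedArguments]
def TwistCoeff (_τ : F →ₐ[P] E) : Type w := E

namespace TwistCoeff

variable (τ : F →ₐ[P] E)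

/-- `TwistCoeff τ` is the field `E`. [folklore] -/
instance instField : Field (TwistCoeff τ) := inferInstanceAs (Field E)

/-- `TwistCoeff τ` is a `P`-algebra as `E` is. [folklore] -/
instance instAlgebraP : Algebra P (TwistCoeff τ) := inferInstanceAs (Algebra P E)

/-- The `F`-algebra structure through `τ`. [folklore] -/
instance instAlgebraF : Algebra F (TwistCoeff τ) := (τ : F →+* E).toAlgebra

/-- `P → F →τ E` is a scalar tower (`τ` is a `P`-algebra map). [folklore] -/
instance instIsScalarTower : IsScalarTower P F (TwistCoeff τ) :=
  IsScalarTower.of_algebraMap_eq fun c => (τ.commutes c).symm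

/-- The identification `E = TwistCoeff τ` as `P`-algebras. [folklore] -/
def toTwist : E ≃ₐ[P] TwistCoeff τ := AlgEquiv.refl

/-- The structure map `F → TwistCoeff τ` is `τ`. [folklore] -/
theorem algebraMap_eq (f : F) : algebraMap F (TwistCoeff τ) f = toTwist τ (τ f) := rfl

end TwistCoeff

variable {Γ : Type u} [Group Γ] (𝔅 : PeriodRingData.{u, v, v', _} Γ P F) (τ : F →ₐ[P] E)

/-- **The `τ`-twisted period ring `B ⊗_{F,τ} E`.** [folklore] -/
abbrev TwistRing : Type _ := 𝔅.B ⊗[F] TwistCoeff τ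

/-- The scalar `1 ⊗ e` of the twisted period ring. [folklore] -/
def twistScalar (e : E) : 𝔅.TwistRing τ := (1 : 𝔅.B) ⊗ₜ[F] TwistCoeff.toTwist τ e

/-- `twistScalar` is a ring homomorphism `E → B ⊗_{F,τ} E`. [folklore] -/
def twistScalarHom : E →+* 𝔅.TwistRing τ :=
  (Algebra.TensorProduct.includeRight : TwistCoeff τ →ₐ[F] 𝔅.TwistRing τ).toRingHom.comp (TwistCoeff.toTwist τ).toRingEquiv.toRingHom

/-- Unfolding lemma for `twistScalarHom`. [folklore] -/
@[simp] theorem twistScalarHom_apply (e : E) : 𝔅.twistScalarHom τ e = 𝔅.twistScalar τ e := rfl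

/-- **`B ⊗_{F,τ} E` is not the zero ring.** [folklore] -/
instance twistRing_nontrivial : Nontrivial (𝔅.TwistRing τ) := by
  let b := Basis.ofVectorSpace F (TwistCoeff τ)
  let β := Algebra.TensorProduct.basis 𝔅.B b
  haveI : Nonempty (Basis.ofVectorSpaceIndex F (TwistCoeff τ)) := b.index_nonempty
  obtain ⟨i⟩ := ‹Nonempty (Basis.ofVectorSpaceIndex F (TwistCoeff τ))›
  exact nontrivial_of_ne (β i) 0 (β.ne_zero i)

variable (n : ℕ)

/-- **`piTwist : (Fin n → E) ⊗_P B → (B ⊗_{F,τ} E)^n`**, `m ⊗ b ↦ (b ⊗ m_i)_i`. [folklore] -/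
def piTwist : (Fin n → E) ⊗[P] 𝔅.B →ₗ[P] (Fin n → 𝔅.TwistRing τ) :=
  TensorProduct.lift (LinearMap.mk₂ P (fun m b => fun i => b ⊗ₜ[F] TwistCoeff.toTwist τ (m i))
    (fun m₁ m₂ b => funext fun i => by simp [tmul_add])
    (fun c m b => funext fun i => by
      simp only [Pi.smul_apply, map_smul]
      rw [tmul_smul])
    (fun m b₁ b₂ => funext fun i => by simp [add_tmul])
    (fun c m b => funext fun i => by
      simp only [Pi.smul_apply]
      rw [smul_tmul']))

/-- `piTwist` on pure tensors. [folklore] -/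
@[simp] theorem piTwist_tmul (m : Fin n → E) (b : 𝔅.B) (i : Fin n) :
    𝔅.piTwist τ n (m ⊗ₜ[P] b) i = b ⊗ₜ[F] TwistCoeff.toTwist τ (m i) := by
  simp [piTwist]

/-- **`piTwist` is `B`-linear**: `piTwist (b' · x) = b' • piTwist x`. [folklore] -/
theorem piTwist_baseActB (b : 𝔅.B) (x : (Fin n → E) ⊗[P] 𝔅.B) :
    𝔅.piTwist τ n (𝔅.baseActB E (Fin n → E) b x) = b • 𝔅.piTwist τ n x := by
  induction x using TensorProduct.induction_on with
  | zero => simp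
  | tmul m c =>
    funext i
    rw [baseActB_tmul, piTwist_tmul, Pi.smul_apply, piTwist_tmul, TensorProduct.smul_tmul', smul_eq_mul]
  | add x y hx hy => rw [map_add, map_add, hx, hy, map_add, smul_add]

/-- **`piTwist` turns the `F`-action into multiplication by `1 ⊗ τ(f)`.** [folklore] -/
theorem piTwist_baseAct (f : F) (x : (Fin n → E) ⊗[P] 𝔅.B) :
    𝔅.piTwist τ n (𝔅.baseAct E (Fin n → E) f x) = 𝔅.twistScalar τ (τ f) • 𝔅.piTwist τ n x := by
  induction x using TensorProduct.induction_on with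
  | zero => simp
  | tmul m c =>
    funext i
    rw [baseAct_tmul, piTwist_tmul, Pi.smul_apply, piTwist_tmul, smul_eq_mul, twistScalar, Algebra.TensorProduct.tmul_mul_tmul,
      one_mul, TensorProduct.smul_tmul, Algebra.smul_def, TwistCoeff.algebraMap_eq]
  | add x y hx hy => rw [map_add, map_add, hx, hy, map_add, smul_add]

/-- **`piTwist` turns the `E`-action into multiplication by `1 ⊗ c`.** [folklore] -/
theorem piTwist_smul (c : E) (x : (Fin n → E) ⊗[P] 𝔅.B) :
    𝔅.piTwist τ n (c • x) = 𝔅.twistScalar τ c • 𝔅.piTwist τ n x := by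
  induction x using TensorProduct.induction_on with
  | zero => simp
  | tmul m b =>
    funext i
    rw [TensorProduct.smul_tmul']
    simp only [piTwist_tmul, Pi.smul_apply, smul_eq_mul, twistScalar, Algebra.TensorProduct.tmul_mul_tmul, one_mul, map_mul]
  | add x y hx hy => rw [smul_add, map_add, hx, hy, map_add, smul_add]

/-- `twistScalar` of a nonzero element is a unit. [folklore] -/
theorem isUnit_twistScalar {e : E} (he : e ≠ 0) : IsUnit (𝔅.twistScalar τ e) := by
  rw [← twistScalarHom_apply]
  exact (IsUnit.mk0 e he).map _

/-- `piTwist` of the standard vector `e_i ⊗ 1` is the standard vector. [folklore] -/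
theorem piTwist_single_tmul_one (i : Fin n) :
    𝔅.piTwist τ n ((Pi.single i (1 : E)) ⊗ₜ[P] (1 : 𝔅.B)) = Pi.single i (1 : 𝔅.TwistRing τ) := by
  funext j
  rw [piTwist_tmul]
  by_cases hij : j = i
  · subst hij
    rw [Pi.single_eq_same, Pi.single_eq_same, map_one]
    rfl
  · rw [Pi.single_eq_of_ne hij, Pi.single_eq_of_ne hij, map_zero, tmul_zero]

end Twist

/-! ### The lower bound on the rank of the `τ`-components -/

section LowerBound

-- Mathlib's own global value of `maxSynthPendingDepth` (the project default `1` makes nested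
-- instance problems on submodules of `M ⊗[P] 𝔅.B` fail spuriously; see `PAdicHodgeProofs`).
set_option maxSynthPendingDepth 3

variable {Γ : Type u} [Group Γ] [TopologicalSpace Γ] {P : Type v} {F : Type v'} [Field P] [Field F] [Algebra P F]
  {E : Type w} [Field E] [Algebra P E] [TopologicalSpace E]
  (𝔅 : PeriodRingData.{u, v, v', _} Γ P F) {n : ℕ} (ρ : ContinuousRep Γ E (Fin n → E)) (τ : F →ₐ[P] E)

/-- **`piTwist` kills the other components**: for `x ∈ D_{τ'}` with `τ' ≠ τ`, `piTwist τ x = 0`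
(on `D_{τ'}` both `1 ⊗ τ(f)` and `1 ⊗ τ'(f)` act as `f`, and `1 ⊗ (τ f - τ' f)` is a unit for
suitable `f`). [folklore] -/
theorem piTwist_eq_zero_of_mem_labelD {τ' : F →ₐ[P] E} (hne : τ' ≠ τ) {x : (Fin n → E) ⊗[P] 𝔅.B}
    (hx : x ∈ 𝔅.labelD ρ τ'.toRingHom) : 𝔅.piTwist τ n x = 0 := by
  obtain ⟨f, hf⟩ : ∃ f, τ' f ≠ τ f := by
    by_contra h
    push Not at h
    exact hne (AlgHom.ext h)
  have h1 : 𝔅.twistScalar τ (τ f) • 𝔅.piTwist τ n x = 𝔅.twistScalar τ (τ' f) • 𝔅.piTwist τ n x := by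
    rw [← piTwist_baseAct, hx.2 f, piTwist_smul]
    rfl
  have h2 : 𝔅.twistScalar τ (τ f - τ' f) • 𝔅.piTwist τ n x = 0 := by
    rw [← twistScalarHom_apply, map_sub, sub_smul, twistScalarHom_apply, twistScalarHom_apply, h1, sub_self]
  obtain ⟨w, hw⟩ := 𝔅.isUnit_twistScalar τ (sub_ne_zero_of_ne hf.symm)
  rw [← hw] at h2
  rw [← one_smul (𝔅.TwistRing τ) (𝔅.piTwist τ n x), ← w.inv_mul, mul_smul, h2, smul_zero]

variable [FiniteDimensional P F] [Algebra.IsSeparable P F]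

/-- **The images of `D_τ` generate `(B ⊗_{F,τ} E)^n`** when `D(ρ)` generates `M ⊗_P B` over `B`
and `E` splits `F`. [folklore] -/
theorem span_piTwist_labelD_eq_top (hsplit : Fintype.card (F →ₐ[P] E) = Module.finrank P F)
    (hspan : ∀ i : Fin n, ∃ (k : ℕ) (b : Fin k → 𝔅.B) (x : Fin k → (Fin n → E) ⊗[P] 𝔅.B),
      (∀ j, x j ∈ 𝔅.coeffD ρ) ∧ ∑ j, 𝔅.baseActB E (Fin n → E) (b j) (x j) = (Pi.single i (1 : E)) ⊗ₜ[P] (1 : 𝔅.B)) :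
    Submodule.span (𝔅.TwistRing τ) (𝔅.piTwist τ n '' (𝔅.labelD ρ τ.toRingHom : Set ((Fin n → E) ⊗[P] 𝔅.B))) = ⊤ := by
  classical
  set S := Submodule.span (𝔅.TwistRing τ) (𝔅.piTwist τ n '' (𝔅.labelD ρ τ.toRingHom : Set ((Fin n → E) ⊗[P] 𝔅.B)))
  -- every element of `D` maps into the span (decompose along the components)
  have hD : ∀ x ∈ 𝔅.coeffD ρ, 𝔅.piTwist τ n x ∈ S := by
    intro x hx
    obtain ⟨z, hz, hsum⟩ := CoeffEigen.exists_sum_eq (U := 𝔅.coeffD ρ) (𝔅.coeffDAct ρ) hsplit (⟨x, hx⟩ : 𝔅.coeffD ρ)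
    have hx' : x = ∑ τ', ((z τ' : 𝔅.coeffD ρ) : (Fin n → E) ⊗[P] 𝔅.B) := by
      rw [← Submodule.coe_sum, hsum]
    rw [hx', map_sum]
    refine Submodule.sum_mem _ fun τ' _ => ?_
    by_cases hτ : τ' = τ
    · subst hτ
      exact Submodule.subset_span ⟨_, (𝔅.mem_eigenSub_coeffDAct_iff ρ τ' _).1 (hz τ'), rfl⟩
    · rw [𝔅.piTwist_eq_zero_of_mem_labelD ρ τ hτ ((𝔅.mem_eigenSub_coeffDAct_iff ρ τ' _).1 (hz τ'))]
      exact zero_mem _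
  -- the standard vectors lie in the span
  have hstd : ∀ i : Fin n, Pi.single i (1 : 𝔅.TwistRing τ) ∈ S := by
    intro i
    obtain ⟨k, b, x, hx, hsum⟩ := hspan i
    rw [← piTwist_single_tmul_one, ← hsum, map_sum]
    refine Submodule.sum_mem _ fun j _ => ?_
    rw [piTwist_baseActB]
    exact Submodule.smul_of_tower_mem _ _ (hD (x j) (hx j))
  -- conclude with the standard basis
  refine eq_top_iff.2 ?_
  rw [← (Pi.basisFun (𝔅.TwistRing τ) (Fin n)).span_eq, Submodule.span_le]
  rintro _ ⟨i, rfl⟩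
  rw [Pi.basisFun_apply]
  exact hstd i

/-- **Rank lower bound `n ≤ dim_E D_τ(ρ)`**: an `E`-basis of `D_τ` maps under `piTwist τ` to a
generating family of the free rank-`n` module over the nonzero commutative ring `B ⊗_{F,τ} E`.
[cite: Patrikis2019, §2.3.1] -/
theorem le_finrank_labelD [FiniteDimensional E (𝔅.labelD ρ τ.toRingHom)]
    (hsplit : Fintype.card (F →ₐ[P] E) = Module.finrank P F)
    (hspan : ∀ i : Fin n, ∃ (k : ℕ) (b : Fin k → 𝔅.B) (x : Fin k → (Fin n → E) ⊗[P] 𝔅.B),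
      (∀ j, x j ∈ 𝔅.coeffD ρ) ∧ ∑ j, 𝔅.baseActB E (Fin n → E) (b j) (x j) = (Pi.single i (1 : E)) ⊗ₜ[P] (1 : 𝔅.B)) :
    n ≤ Module.finrank E (𝔅.labelD ρ τ.toRingHom) := by
  classical
  set d := Module.finrank E (𝔅.labelD ρ τ.toRingHom)
  let u := Module.finBasis E (𝔅.labelD ρ τ.toRingHom)
  -- the images of the basis generate
  let v : Fin d → (Fin n → 𝔅.TwistRing τ) := fun j => 𝔅.piTwist τ n (u j)
  have hv : Submodule.span (𝔅.TwistRing τ) (Set.range v) = ⊤ := by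
    refine eq_top_iff.2 ?_
    rw [← 𝔅.span_piTwist_labelD_eq_top ρ τ hsplit hspan, Submodule.span_le]
    rintro _ ⟨x, hx, rfl⟩
    have hrepr : x = ∑ j, (u.repr ⟨x, hx⟩ j) • ((u j : 𝔅.labelD ρ τ.toRingHom) : (Fin n → E) ⊗[P] 𝔅.B) := by
      conv_lhs => rw [show x = ((⟨x, hx⟩ : 𝔅.labelD ρ τ.toRingHom) : (Fin n → E) ⊗[P] 𝔅.B) from rfl, ← u.sum_repr ⟨x, hx⟩]
      rw [Submodule.coe_sum]
      rfl
    rw [SetLike.mem_coe, hrepr, map_sum]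
    refine Submodule.sum_mem _ fun j _ => ?_
    rw [piTwist_smul]
    exact Submodule.smul_mem _ _ (Submodule.subset_span ⟨j, rfl⟩)
  have hsurj : Function.Surjective (Fintype.linearCombination (𝔅.TwistRing τ) v) := by
    rw [← LinearMap.range_eq_top, Fintype.range_linearCombination, hv]
  exact le_of_fin_surjective (𝔅.TwistRing τ) (Fintype.linearCombination (𝔅.TwistRing τ) v) hsurj

/-- **Rank formula `dim_E D_τ(ρ) = n`** from the lower bounds and the total bound
`dim_E D(ρ) ≤ n [F : P]`. [cite: Patrikis2019, §2.3.1] -/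
theorem finrank_labelD_eq_of_finrank_coeffD_le [FiniteDimensional E (𝔅.coeffD ρ)]
    (hsplit : Fintype.card (F →ₐ[P] E) = Module.finrank P F)
    (hspan : ∀ i : Fin n, ∃ (k : ℕ) (b : Fin k → 𝔅.B) (x : Fin k → (Fin n → E) ⊗[P] 𝔅.B),
      (∀ j, x j ∈ 𝔅.coeffD ρ) ∧ ∑ j, 𝔅.baseActB E (Fin n → E) (b j) (x j) = (Pi.single i (1 : E)) ⊗ₜ[P] (1 : 𝔅.B))
    (htotal : Module.finrank E (𝔅.coeffD ρ) ≤ n * Module.finrank P F) (τ : F →ₐ[P] E) :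
    Module.finrank E (𝔅.labelD ρ τ.toRingHom) = n := by
  haveI : ∀ τ' : F →ₐ[P] E, FiniteDimensional E (𝔅.labelD ρ τ'.toRingHom) :=
    fun τ' => Submodule.finiteDimensional_of_le (𝔅.labelD_le_coeffD ρ _)
  have hsum : Module.finrank E (𝔅.coeffD ρ) = ∑ τ' : F →ₐ[P] E, Module.finrank E (𝔅.labelD ρ τ'.toRingHom) := by
    rw [CoeffEigen.finrank_eq_sum_finrank_eigenSub (U := 𝔅.coeffD ρ) (𝔅.coeffDAct ρ) hsplit]
    exact Finset.sum_congr rfl fun τ' _ => 𝔅.finrank_eigenSub_coeffDAct ρ τ'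
  refine CoeffEigen.eq_of_sum_le_of_le (d := fun τ' : F →ₐ[P] E => Module.finrank E (𝔅.labelD ρ τ'.toRingHom)) ?_
    (fun τ' => 𝔅.le_finrank_labelD ρ τ' hsplit hspan) τ
  rw [← hsum, hsplit]
  exact htotal

end LowerBound

end PeriodRingData

end Literature.NumberTheory.GaloisRepresentations

end
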